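import Literature.MathematicalPhysics.QuantumFieldTheory.Balaban1983to89.B3DivergentGraphs

/-!
# `Balaban1983to89.B3OddVectorLoops` — T. Bałaban, *(Higgs)₂,₃ quantum fields in a finite volume. III. Renormalization*,
Commun. Math. Phys. **88** (1983) 411–445 [Balaban1983Higgs3]: p. 434, *"every graph of this type has at least one loop of scalar
field lines with an odd number of vector field legs"*, DECIDED on the concrete family of graphs `B3Cor23Concrete.Graph`

statement-level skeleton of published theorems with citation tags; proofs where landed; nothing here is a claim about the Yang–Mills mass gap

PDF held: `paper:balaban1983-higgs-2-3-quantum-fields-finite-volume` (journal page = PDF page + 410); renders read as images: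
`…/b2b-balaban-ref1/pages/1983-cmp88-higgs23-III/1983-cmp88-higgs23-III-p003, p004, p024-x2.png` (pp. 413, 414, 434).
CITATION HEADER (lean-in-tree rule).  lit-balaban TYPED SKELETON (HOME `run/shared/lean/pub/lit-balaban/`), Phase 2, seat p18
(gen 2), unit `lit-balaban-p18`: SKELETON row **B3.Txt@434** (owner r15; `proved p239134` for the algebraic half tr q^{2n+1} = 0,
`B3Sect2StatementsPart2.trace_pow_odd_eq_zero_of_transpose_eq_neg`), p. 434 [PDF 24], verbatim: *"At first let us remark that the
expressions corresponding to graphs with an odd number of external vector field legs (and no other external legs) are equal to 0.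
This follows from the fact that every graph of this type has at least one loop of scalar field lines with an odd number of vector
field legs, thus with an odd power of q, and we have tr q^{2n+1} = 0. Thus we have no divergent subgraphs with one or three external
vector field legs."*  This module proves the GRAPH-THEORETIC half on the model `B3Cor23Concrete` (seat p18 gen 1).

READING (recorded, F6).  The scalar legs of a vertex are paired into STRANDS by the internal-index structure of the vertex: (1.6) =
−λη^d|φ′|⁴ = −λη^d(φ′·φ′)(φ′·φ′) has the strands {legs 0,1} and {legs 2,3}; (1.7)–(1.11) (two φ′-legs in one bilinear form
⟨·, q^{n+n′}·⟩, pp. 413–414) have the strand {0,1}, which carries the q-power n + n′ = (A′-legs) + (Ã-legs) of the vertex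
(`VertexKind.dv`, `dv_eq_vectorLegs_add`); the single φ′-leg of (1.13)–(1.15) is a strand by itself.  A *loop of scalar field
lines* is a class of φ′-legs under «joined by an internal line or by a strand» (`SameLoop`); when every φ′-leg is internal and no
vertex (1.13)–(1.15) occurs these classes are exactly the closed alternating cycles line–strand–line–… of the pictures; in general
they are the maximal chains.  The *number of vector field legs of a loop* = Σ over its strands of n + n′ (`loopVecLegs`).

WHAT THIS MODULE PROVES (sorry-free; defs with bodies only; no `Prop` fact introduced).  `sum_vecLegsAt`/`sum_dv_eq`: the total
q-power over all strands is (internal A′-legs) + (external A′-legs) + (Ã-legs), and the internal A′-legs are even in number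
(`even_sum_intVector`: they pair up along the vector lines); the classes `loopOf` partition the φ′-legs (`sum_eq_sum_loops`);
hence **`exists_odd_loop`**: if the number of external vector legs (uncontracted A′-legs plus Ã-legs) is ODD, some loop carries an
odd number of vector field legs — for EVERY graph of the model (no hypothesis on the scalar legs is needed for the parity count;
the closed-loop reading needs all φ′-legs internal, `loopOf_closed`).  NOT here: the vanishing of the expression (the algebraic
half is r15's theorem cited above; the Gaussian evaluation attaching tr q^{(power of the loop)} to a closed loop is not formalised).
-/

namespace Literature.MathematicalPhysics.QuantumFieldTheory.Balaban1983to89.B3OddVectorLoops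

open Finset B3Prop1 B3Sect2Statements B3VertexBridge B3Cor23Concrete B3DivergentGraphs

variable {nbar : ℕ} (G : Graph nbar)

/-! ## Strands -/

/-- The strand mate of a leg index: 0 ↔ 1, 2 ↔ 3, … (the pairing (φ′·φ′)(φ′·φ′) of (1.6) and the bilinear forms of (1.7)–(1.11)).
[cite: Balaban1983Higgs3, (1.6)–(1.11) p.413] -/
def mateNat (n : ℕ) : ℕ := if n % 2 = 0 then n + 1 else n - 1

/-- kernel: the strand pairing is an involution. [cite: Balaban1983Higgs3, (1.6)–(1.11) p.413] -/
theorem mateNat_mateNat (n : ℕ) : mateNat (mateNat n) = n := by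
  unfold mateNat; split_ifs <;> omega

/-- kernel: no leg is its own strand mate. [cite: Balaban1983Higgs3, (1.6)–(1.11) p.413] -/
theorem mateNat_ne (n : ℕ) : mateNat n ≠ n := by
  unfold mateNat; split_ifs <;> omega

/-- The φ′-legs of G as pairs (vertex, index of the leg). [cite: Balaban1983Higgs3, (1.17) p.415] -/
abbrev SLeg : Type := Σ i : Fin G.nV, Fin (G.kind i).scalarLegs

/-- Adjacency of φ′-legs: joined by an internal scalar line of G, or forming a strand of one vertex.
[cite: Balaban1983Higgs3, p.434] -/
def Adj (x y : SLeg G) : Prop :=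
  G.other ⟨x.1, .inl x.2⟩ = some ⟨y.1, .inl y.2⟩ ∨ (x.1 = y.1 ∧ (y.2 : ℕ) = mateNat x.2)

/-- «On the same loop of scalar field lines» (p. 434): the equivalence generated by `Adj`. [cite: Balaban1983Higgs3, p.434] -/
def SameLoop : SLeg G → SLeg G → Prop := Relation.EqvGen (Adj G)

open Classical in
/-- The loop of scalar field lines through the φ′-leg `x` (as the set of its φ′-legs). [cite: Balaban1983Higgs3, p.434] -/
noncomputable def loopOf (x : SLeg G) : Finset (SLeg G) := univ.filter fun y => SameLoop G x y

/-- The vector field legs carried by the strand through `x`: the q-power n + n′ = (A′-legs) + (Ã-legs) of the vertex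
(`VertexKind.dv`), attached to the leg of index 0 of each vertex (one strand per bilinear form; (1.6) carries q⁰).
[cite: Balaban1983Higgs3, (1.8)–(1.11) p.413] -/
def vecLegsAt (x : SLeg G) : ℕ := if (x.2 : ℕ) = 0 then (G.kind x.1).dv else 0

/-- The number of vector field legs of the loop through `x` (p. 434: *"loop of scalar field lines with an odd number of vector
field legs, thus with an odd power of q"*). [cite: Balaban1983Higgs3, p.434] -/
noncomputable def loopVecLegs (x : SLeg G) : ℕ := ∑ y ∈ loopOf G x, vecLegsAt G y

/-! ## Loops partition the φ′-legs -/

/-- kernel: a leg lies on its own loop. [cite: Balaban1983Higgs3, p.434] -/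
theorem mem_loopOf_self (x : SLeg G) : x ∈ loopOf G x := by
  classical
  simp only [loopOf, mem_filter, mem_univ, true_and]
  exact Relation.EqvGen.refl x

/-- kernel: loops are closed under lines and strands. [cite: Balaban1983Higgs3, p.434] -/
theorem loopOf_closed {x y z : SLeg G} (hy : y ∈ loopOf G x) (hz : Adj G y z) : z ∈ loopOf G x := by
  classical
  simp only [loopOf, mem_filter, mem_univ, true_and] at hy ⊢
  exact Relation.EqvGen.trans _ _ _ hy (Relation.EqvGen.rel _ _ hz)

/-- kernel: two loops sharing a leg coincide. [cite: Balaban1983Higgs3, p.434] -/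
theorem loopOf_eq_of_mem {x y : SLeg G} (h : y ∈ loopOf G x) : loopOf G y = loopOf G x := by
  classical
  simp only [loopOf, mem_filter, mem_univ, true_and] at h
  ext z
  simp only [loopOf, mem_filter, mem_univ, true_and]
  exact ⟨fun hz => Relation.EqvGen.trans _ _ _ h hz,
    fun hz => Relation.EqvGen.trans _ _ _ (Relation.EqvGen.symm _ _ h) hz⟩

/-- The set of loops of G. [cite: Balaban1983Higgs3, p.434] -/
noncomputable def loops : Finset (Finset (SLeg G)) := univ.image (loopOf G)

/-- kernel: distinct loops are disjoint. [cite: Balaban1983Higgs3, p.434] -/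
theorem loops_pairwiseDisjoint : (loops G : Set (Finset (SLeg G))).PairwiseDisjoint id := by
  intro c hc d hd hne
  simp only [loops, coe_image, coe_univ, Set.image_univ, Set.mem_range] at hc hd
  obtain ⟨a, rfl⟩ := hc
  obtain ⟨b, rfl⟩ := hd
  rw [Function.onFun, id, id, Finset.disjoint_left]
  intro z hza hzb
  exact hne ((loopOf_eq_of_mem G hza).symm.trans (loopOf_eq_of_mem G hzb))

/-- kernel: the loops cover the φ′-legs. [cite: Balaban1983Higgs3, p.434] -/
theorem biUnion_loops : (loops G).biUnion id = univ := by
  ext x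
  simp only [mem_biUnion, id, mem_univ, iff_true]
  exact ⟨loopOf G x, mem_image_of_mem _ (mem_univ x), mem_loopOf_self G x⟩

/-- kernel: a sum over all φ′-legs is the sum over the loops of the sums over each loop. [cite: Balaban1983Higgs3, p.434] -/
theorem sum_eq_sum_loops (f : SLeg G → ℕ) : ∑ x, f x = ∑ c ∈ loops G, ∑ y ∈ c, f y := by
  have h := sum_biUnion (f := f) (loops_pairwiseDisjoint G)
  rw [biUnion_loops] at h
  simpa using h

/-! ## Counting the vector field legs -/

/-- kernel: every catalogue vertex has a φ′-leg of index 0 (4, 2 or 1 φ′-legs). [cite: Balaban1983Higgs3, (1.6)–(1.15) pp.413–414] -/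
theorem scalarLegs_pos (v : VertexKind) : 0 < v.scalarLegs := by
  cases v <;> simp [VertexKind.scalarLegs]

/-- kernel: summing the strand weights over all φ′-legs gives Σ_v (n + n′) = Σ_v d_v(v) (one leg of index 0 per vertex).
[cite: Balaban1983Higgs3, p.420] -/
theorem sum_vecLegsAt : ∑ x : SLeg G, vecLegsAt G x = ∑ i, (G.kind i).dv := by
  rw [Fintype.sum_sigma]
  refine sum_congr rfl fun i _ => ?_
  have h0 : 0 < (G.kind i).scalarLegs := scalarLegs_pos _
  have hset : (univ.filter fun j : Fin (G.kind i).scalarLegs => (j : ℕ) = 0) = {⟨0, h0⟩} := by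
    ext j; simp [Fin.ext_iff]
  simp only [vecLegsAt]
  rw [sum_ite, sum_const_zero, add_zero, sum_const, hset, card_singleton, one_smul]

/-- The internal A′-legs of G. [cite: Balaban1983Higgs3, p.414] -/
def intVectorLegSet : Finset (Leg G.kind) := univ.filter fun x => x.2.isLeft = false ∧ (G.other x).isSome = true

/-- kernel: the internal A′-legs counted vertex by vertex. [cite: Balaban1983Higgs3, (2.1) p.422] -/
theorem card_intVectorLegSet : (intVectorLegSet G).card = ∑ i, G.intVector i := by
  unfold intVectorLegSet Graph.intVector
  rw [card_filter, Fintype.sum_sigma]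
  refine sum_congr rfl fun i _ => ?_
  rw [Fintype.sum_sum_type, card_filter]
  simp

/-- p. 414 [PDF 4], verbatim: *"All the A′-legs are contracted, i.e. they are divided into pairs and each pair is replaced by the
corresponding propagator."* — kernel: the internal A′-legs of a graph of the model are EVEN in number («the other endpoint» is a
fixed-point-free involution on them; the φ′ case is `B3ScalarLegParity.even_card_intScalarLegSet`). [cite: Balaban1983Higgs3, p.414] -/
theorem even_card_intVectorLegSet : Even (intVectorLegSet G).card := by
  have hget : ∀ a (ha : a ∈ intVectorLegSet G), G.other a = some ((G.other a).get (mem_filter.mp ha).2.2) :=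
    fun a ha => (Option.some_get _).symm
  have hsum : ∑ x ∈ intVectorLegSet G, (1 : ZMod 2) = 0 := by
    refine sum_involution (fun a ha => (G.other a).get (mem_filter.mp ha).2.2) (fun a ha => by decide)
      (fun a ha _ => ?_) (fun a ha => ?_) (fun a ha => ?_)
    · intro heq
      exact G.other_ne a a (by rw [hget a ha, heq]) rfl
    · have hmem := mem_filter.mp ha
      refine mem_filter.mpr ⟨mem_univ _, ?_, ?_⟩
      · rw [← G.other_isLeft _ _ (hget a ha)]; exact hmem.2.1
      · rw [G.other_symm _ _ (hget a ha)]; rfl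
    · have := G.other_symm _ _ (hget a ha)
      simp [this]
  have hcard : ((intVectorLegSet G).card : ZMod 2) = 0 := by
    rw [← hsum, sum_const, nsmul_eq_mul, mul_one]
  exact ZMod.natCast_eq_zero_iff_even.mp hcard

/-- kernel: the internal A′-legs counted vertex by vertex are even in number. [cite: Balaban1983Higgs3, p.414] -/
theorem even_sum_intVector : Even (∑ i, G.intVector i) := by
  rw [← card_intVectorLegSet]; exact even_card_intVectorLegSet G

/-- kernel: Σ_v (n + n′) = (internal A′-legs) + (external A′-legs) + (Ã-legs) — every vector leg of every vertex is one of the three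
(`VertexKind.dv_eq_vectorLegs_add`). [cite: Balaban1983Higgs3, p.420] -/
theorem sum_dv_eq : ∑ i, (G.kind i).dv = (∑ i, G.intVector i) + numExtVectorLegs G + numTildeLegs G := by
  unfold numExtVectorLegs numTildeLegs
  rw [← sum_add_distrib, ← sum_add_distrib]
  refine sum_congr rfl fun i _ => ?_
  rw [VertexKind.dv_eq_vectorLegs_add]
  have := G.intVector_le i
  omega

/-- kernel: the total q-power over all strands has the parity of the number of external vector legs (A′ and Ã).
[cite: Balaban1983Higgs3, p.434] -/
theorem odd_sum_vecLegsAt (hodd : Odd (numExtVectorLegs G + numTildeLegs G)) : Odd (∑ x : SLeg G, vecLegsAt G x) := by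
  rw [sum_vecLegsAt, sum_dv_eq, add_assoc]
  exact (even_sum_intVector G).add_odd hodd

/-- **p. 434** [PDF 24], verbatim: *"every graph of this type has at least one loop of scalar field lines with an odd number of vector
field legs, thus with an odd power of q"* — PROVED for EVERY graph of the model whose number of external vector legs (uncontracted
A′-legs plus Ã-legs) is odd, in particular for the graphs with one or three external vector legs and no other external legs of
the printed sentence: some loop of scalar field lines (`loopOf`) carries an odd number of vector field legs (`loopVecLegs`).  With
tr q^{2n+1} = 0 (`B3Sect2StatementsPart2.trace_pow_odd_eq_zero_of_transpose_eq_neg`, r15) this is the printed reason why such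
expressions vanish. [cite: Balaban1983Higgs3, p.434] -/
theorem exists_odd_loop (hodd : Odd (numExtVectorLegs G + numTildeLegs G)) : ∃ x : SLeg G, Odd (loopVecLegs G x) := by
  by_contra hno
  push Not at hno
  have heven : ∀ c ∈ loops G, Even (∑ y ∈ c, vecLegsAt G y) := by
    intro c hc
    simp only [loops, mem_image, mem_univ, true_and] at hc
    obtain ⟨x, rfl⟩ := hc
    exact Nat.not_odd_iff_even.mp (hno x)
  have htot : Even (∑ x : SLeg G, vecLegsAt G x) := by
    rw [sum_eq_sum_loops]; exact even_sum _ heven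
  exact Nat.not_even_iff_odd.mpr (odd_sum_vecLegsAt G hodd) htot

/-- p. 434, the two cases named in print: a graph with exactly one or exactly three external vector field legs (A′ and Ã together) has
a loop of scalar field lines with an odd number of vector field legs. [cite: Balaban1983Higgs3, p.434] -/
theorem exists_odd_loop_of_one_or_three (h : numExtVectorLegs G + numTildeLegs G = 1 ∨ numExtVectorLegs G + numTildeLegs G = 3) :
    ∃ x : SLeg G, Odd (loopVecLegs G x) :=
  exists_odd_loop G (by rcases h with h | h <;> rw [h] <;> decide)

end Literature.MathematicalPhysics.QuantumFieldTheory.Balaban1983to89.B3OddVectorLoops
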